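import Mathlib
import Summits.KontsevichZagierPeriods.Zeta5Search.Families.CoeffAsympTypes
import HarnessLib

/-!
# ζ(5) search — Families: coefficient asymptotics of powers of a positive polynomial, II — the FACE of the base exponent

HONEST FRAMING: systematic search; no irrationality claim unless certified.  Cell `pub-zeta5`, certifier 2
(cert-2 g9, 2026-08-22).  Elementary linear algebra / combinatorics of exponent vectors; no conjecture node is used;
nothing about `ζ(5)`; no number of record moves.

For a finite set of monomials `S` and a base exponent `B` a (non-negative real) RELATION is `μ ≥ 0` on `S` with
`Σ_α μ_α (α − B) = 0`.  The FACE `face S B` is the set of `α ∈ S` carried by some relation (`μ_α > 0`);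
geometrically, the monomials on the minimal face of the Newton polytope `conv S` containing `B`.
* `mem_face_of_type` — every TYPE of length `n` and exponent `n • B` (`Families/CoeffAsympTypes`) is supported in the
  face (its multiplicities are an integer relation); hence **`coeff_pow_le_tilt_face_pow`**:
  `[x^{nB}] (poly S c)ⁿ ≤ (tilt (face S B) c B u)ⁿ` for every `u` — only the face matters for the upper bound;
* `self_mem_face` — `B ∈ face S B` when `B ∈ S`;
* **`exists_pos_relation`** — there is ONE relation positive on the whole face and zero off it (sum of witnesses).
Standard axioms only.
-/

noncomputable section

open MvPolynomial Finset Real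

namespace Summit.KontsevichZagierPeriods.Zeta5Search.Families.Cellular

namespace CoeffAsymp

variable {d : ℕ}

/-- **The face of `B` in `S`**: the monomials `α ∈ S` with `μ_α > 0` for some non-negative real RELATION `μ`
among the vectors `β − B`, `β ∈ S` (`μ ≥ 0` on `S`, `Σ_{β ∈ S} μ_β (β − B) = 0`). -/
def face (S : Finset (Fin d →₀ ℕ)) (B : Fin d →₀ ℕ) : Finset (Fin d →₀ ℕ) := by
  classical
  exact S.filter fun α => ∃ μ : (Fin d →₀ ℕ) → ℝ,
    ((∀ β ∈ S, 0 ≤ μ β) ∧ ∀ i, ∑ β ∈ S, μ β * dvec B β i = 0) ∧ 0 < μ α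

/-- Membership in the face. -/
theorem mem_face {S : Finset (Fin d →₀ ℕ)} {B α : Fin d →₀ ℕ} :
    α ∈ face S B ↔ α ∈ S ∧ ∃ μ : (Fin d →₀ ℕ) → ℝ,
      ((∀ β ∈ S, 0 ≤ μ β) ∧ ∀ i, ∑ β ∈ S, μ β * dvec B β i = 0) ∧ 0 < μ α := by
  classical
  unfold face
  rw [Finset.mem_filter]

/-- The face is a subset of `S`. -/
theorem face_subset (S : Finset (Fin d →₀ ℕ)) (B : Fin d →₀ ℕ) : face S B ⊆ S :=
  fun _ h => (mem_face.1 h).1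

/-- `dvec B B = 0`. -/
theorem dvec_self (B : Fin d →₀ ℕ) : dvec B B = 0 := by
  funext i; simp [dvec]

/-- `B` lies on its own face (the relation `δ_B`). -/
theorem self_mem_face {S : Finset (Fin d →₀ ℕ)} {B : Fin d →₀ ℕ} (hB : B ∈ S) : B ∈ face S B := by
  classical
  refine mem_face.2 ⟨hB, fun α => if α = B then 1 else 0, ⟨fun α _ => ?_, fun i => ?_⟩, by simp⟩
  · show (0 : ℝ) ≤ if α = B then 1 else 0
    split_ifs <;> norm_num
  rw [Finset.sum_eq_single B (fun α _ hα => by simp [hα]) (fun h => absurd hB h)]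
  simp [dvec_self]

/-- The multiplicities of a type of length `n` and exponent `n • B` form an (integer) relation:
`Σ_α k_α (α_i − B_i) = 0` for every coordinate `i`. -/
theorem sum_mul_dvec_eq_zero {S : Finset (Fin d →₀ ℕ)} {n : ℕ} {k : (Fin d →₀ ℕ) → ℕ} {B : Fin d →₀ ℕ}
    (hk : k ∈ S.piAntidiag n) (hkB : typeExp S k = n • B) (i : Fin d) :
    ∑ α ∈ S, (k α : ℝ) * dvec B α i = 0 := by
  rw [Finset.mem_piAntidiag] at hk
  have hsum : ∑ α ∈ S, (k α : ℝ) = n := by exact_mod_cast hk.1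
  have h1 : ((typeExp S k i : ℕ) : ℝ) = ((n • B) i : ℕ) := by rw [hkB]
  rw [typeExp_apply] at h1
  simp only [Finsupp.smul_apply, smul_eq_mul, Nat.cast_sum, Nat.cast_mul] at h1
  unfold dvec
  simp_rw [mul_sub, Finset.sum_sub_distrib, ← Finset.sum_mul, h1, hsum]
  ring

/-- **Types of exponent `n • B` live on the face.** -/
theorem mem_face_of_type {S : Finset (Fin d →₀ ℕ)} {n : ℕ} {k : (Fin d →₀ ℕ) → ℕ} {B : Fin d →₀ ℕ}
    (hk : k ∈ S.piAntidiag n) (hkB : typeExp S k = n • B) {α : Fin d →₀ ℕ} (hα : α ∈ S) (hkα : k α ≠ 0) :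
    α ∈ face S B :=
  mem_face.2 ⟨hα, fun β => (k β : ℝ), ⟨fun β _ => Nat.cast_nonneg _, fun i => sum_mul_dvec_eq_zero hk hkB i⟩, by
    show (0 : ℝ) < (k α : ℝ)
    exact_mod_cast Nat.pos_of_ne_zero hkα⟩

/-- **Only the face matters for the upper bound**: `[x^{nB}] (poly S c)ⁿ ≤ (tilt (face S B) c B u)ⁿ` for every
`u ∈ ℝ^d` (`c ≥ 0` on `S`). -/
theorem coeff_pow_le_tilt_face_pow {S : Finset (Fin d →₀ ℕ)} {c : (Fin d →₀ ℕ) → ℝ} (hc : ∀ α ∈ S, 0 ≤ c α)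
    (n : ℕ) (B : Fin d →₀ ℕ) (u : Fin d → ℝ) :
    coeff (n • B) (poly S c ^ n) ≤ tilt (face S B) c B u ^ n :=
  coeff_pow_le_tilt_pow hc (face_subset S B) (fun _ hk hkB _ hα hkα => mem_face_of_type hk hkB hα hkα) u

/-- Relations are closed under finite sums. -/
theorem relation_sum {S : Finset (Fin d →₀ ℕ)} {B : Fin d →₀ ℕ} {ι : Type*} (T : Finset ι)
    (μ : ι → (Fin d →₀ ℕ) → ℝ) (h : ∀ t ∈ T, (∀ β ∈ S, 0 ≤ μ t β) ∧ ∀ i, ∑ β ∈ S, μ t β * dvec B β i = 0) :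
    (∀ β ∈ S, 0 ≤ ∑ t ∈ T, μ t β) ∧ ∀ i, ∑ β ∈ S, (∑ t ∈ T, μ t β) * dvec B β i = 0 := by
  refine ⟨fun α hα => Finset.sum_nonneg fun t ht => (h t ht).1 α hα, fun i => ?_⟩
  calc ∑ α ∈ S, (∑ t ∈ T, μ t α) * dvec B α i = ∑ t ∈ T, ∑ α ∈ S, μ t α * dvec B α i := by
        rw [Finset.sum_comm]
        exact Finset.sum_congr rfl fun α _ => Finset.sum_mul _ _ _
    _ = 0 := Finset.sum_eq_zero fun t ht => (h t ht).2 i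

/-- **A relation positive on the whole face and zero off it.** -/
theorem exists_pos_relation (S : Finset (Fin d →₀ ℕ)) (B : Fin d →₀ ℕ) :
    ∃ μ : (Fin d →₀ ℕ) → ℝ, ((∀ β ∈ S, 0 ≤ μ β) ∧ ∀ i, ∑ β ∈ S, μ β * dvec B β i = 0) ∧
      (∀ α ∈ face S B, 0 < μ α) ∧ ∀ α ∈ S, α ∉ face S B → μ α = 0 := by
  classical
  -- a witness for each point of the face
  have hw : ∀ α ∈ face S B, ∃ μ : (Fin d →₀ ℕ) → ℝ,
      ((∀ β ∈ S, 0 ≤ μ β) ∧ ∀ i, ∑ β ∈ S, μ β * dvec B β i = 0) ∧ 0 < μ α := fun α hα => (mem_face.1 hα).2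
  choose! w hw using hw
  refine ⟨fun β => ∑ α ∈ face S B, w α β, relation_sum _ _ fun α hα => (hw α hα).1, fun β hβ => ?_,
    fun β hβS hβ => ?_⟩
  · -- positivity at `β`: the witness of `β` contributes `w β β > 0`, the others are `≥ 0`
    have hle : w β β ≤ ∑ α ∈ face S B, w α β :=
      Finset.single_le_sum (f := fun α => w α β) (fun α hα => (hw α hα).1.1 β (face_subset S B hβ)) hβ
    exact lt_of_lt_of_le (hw β hβ).2 hle
  · -- off the face every witness vanishes at `β` (else `β` would be on the face)
    refine Finset.sum_eq_zero fun α hα => ?_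
    have h0 : 0 ≤ w α β := (hw α hα).1.1 β hβS
    rcases h0.lt_or_eq with hpos | hzero
    · exact absurd (mem_face.2 ⟨hβS, w α, (hw α hα).1, hpos⟩) hβ
    · exact hzero.symm

/-- The positive relation restricted to the face: `Σ_{α ∈ face} μ_α (α_i − B_i) = 0`. -/
theorem exists_pos_relation_face (S : Finset (Fin d →₀ ℕ)) (B : Fin d →₀ ℕ) :
    ∃ μ : (Fin d →₀ ℕ) → ℝ, (∀ α ∈ face S B, 0 < μ α) ∧ ∀ i, ∑ α ∈ face S B, μ α * dvec B α i = 0 := by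
  obtain ⟨μ, hrel, hpos, hzero⟩ := exists_pos_relation S B
  refine ⟨μ, hpos, fun i => ?_⟩
  rw [← hrel.2 i]
  refine (Finset.sum_subset (face_subset S B) fun α hαS hα => ?_)
  rw [hzero α hαS hα, zero_mul]

end CoeffAsymp

end Summit.KontsevichZagierPeriods.Zeta5Search.Families.Cellular
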